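import Mathlib.Logic.Relation
import HarnessLib

/-!
# Venture HSemireg — deleting a loop-free node of a digraph preserves every closed walk

Elementary bookkeeping behind «LEMMA PRUNE» of the computation cell `pub-hsemireg`
(seat w1-cx-2, `widen/W1/w1cx2/scgameB/README.md` §2; the instrument is the second code of
the SELF-CONSISTENT PLACEMENT GAME of `widen/W1/cx1/W1-CX-SCGAME.md`). There, a finite
«potential graph» on occupied nodes is searched for occupancy patterns in which every
obstruction-carrying letter keeps a LOOPED node — a node `v` lying on a closed walk through some
other node, `∃ w ≠ v, v →⁺ w →⁺ v` (equivalently, its strongly connected component has at least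
two nodes); a node is LOOP-FREE if it is not looped. The search prunes loop-free nodes, and the
two kill rules of the card («weak»: a letter dies iff all its nodes are loop-free; «sharp»: iff
some node is loop-free) agree cell by cell. Both facts rest on one remark, proved here for an
arbitrary relation `R` on a type `V`; deleting a vertex `u` means passing to the relation
`fun x y => R x y ∧ x ≠ u ∧ y ≠ u`, deleting a list `l` to `fun x y => R x y ∧ x ∉ l ∧ y ∉ l`
(both written inline; no named predicates):

* `transGen_avoid_or_through` — a path `a →⁺ b` either avoids a given vertex `u` entirely
  (it is a path of the `u`-deleted relation) or passes through `u` (`a →* u →* b`);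
* `looped_delete_of_loopFree` — **LEMMA PRUNE**: if `u` is loop-free then every looped vertex
  is still looped after deleting `u` (a closed walk `v →⁺ w →⁺ v`, `w ≠ v`, cannot pass through
  `u`, else `u` would lie on a closed walk through `v ≠ u`); `looped_delete_iff` is the
  resulting equivalence, `looped_of_looped_sub` the monotonicity in the relation, and
  `looped_deleteList_of_loopFree` deletes a whole list of loop-free vertices at once (the form
  the game uses: all loop-free nodes of the target letters are dropped together, which turns an
  alive «weak» pattern into an alive «sharp» pattern).

HONEST FRAMING. Reachability bookkeeping for an abstract relation only; the Lean index of one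
step of a NECESSARY-condition sieve used by the cell. No sheaf, complex, abelian variety or
semiregularity map appears; nothing here says that HC, HC_CM or HC_AV holds, and nothing here is
a new case of anything.
-/

namespace Summit.Ventures.HSemireg

namespace LoopFreePruning

open Relation

variable {V : Type*}

/-- Loopedness is monotone in the relation: if `R ≤ S` and `v` lies on a closed walk of `R`
through another vertex, it does so for `S`. In particular deleting vertices never creates a
looped vertex. -/
theorem looped_of_looped_sub {R S : V → V → Prop} (h : R ≤ S) {v : V}
    (hv : ∃ w, w ≠ v ∧ TransGen R v w ∧ TransGen R w v) :
    ∃ w, w ≠ v ∧ TransGen S v w ∧ TransGen S w v := by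
  obtain ⟨w, hw, h1, h2⟩ := hv
  exact ⟨w, hw, TransGen.mono h _ _ h1, TransGen.mono h _ _ h2⟩

/-- A reflexive-transitive path between distinct vertices is a transitive path. -/
theorem transGen_of_reflTransGen_ne {R : V → V → Prop} {a b : V} (h : ReflTransGen R a b)
    (hne : b ≠ a) : TransGen R a b := by
  rcases (reflTransGen_iff_eq_or_transGen).1 h with hb | ht
  · exact absurd hb hne
  · exact ht

/-- A path `a →⁺ b` of `R` either is a path of the `u`-deleted relation (it avoids `u`
altogether) or passes through `u`: `a →* u` and `u →* b`. -/
theorem transGen_avoid_or_through {R : V → V → Prop} (u : V) {a b : V}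
    (h : TransGen R a b) :
    TransGen (fun x y => R x y ∧ x ≠ u ∧ y ≠ u) a b ∨
      (ReflTransGen R a u ∧ ReflTransGen R u b) := by
  induction h with
  | single hab =>
      rename_i b
      by_cases ha : a = u
      · subst ha
        exact Or.inr ⟨ReflTransGen.refl, ReflTransGen.single hab⟩
      · by_cases hb : b = u
        · subst hb
          exact Or.inr ⟨ReflTransGen.single hab, ReflTransGen.refl⟩
        · exact Or.inl (TransGen.single ⟨hab, ha, hb⟩)
  | tail hac hcb ih =>
      rename_i c b
      rcases ih with hR | ⟨hau, huc⟩
      · by_cases hb : b = u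
        · subst hb
          have hle : (fun x y => R x y ∧ x ≠ b ∧ y ≠ b) ≤ R := fun _ _ h => h.1
          exact Or.inr ⟨(TransGen.mono hle _ _ hR).to_reflTransGen.tail hcb, ReflTransGen.refl⟩
        · have hc : c ≠ u := by
            obtain ⟨d, _, hdc⟩ := (TransGen.tail'_iff).1 hR
            exact hdc.2.2
          exact Or.inl (hR.tail ⟨hcb, hc, hb⟩)
      · exact Or.inr ⟨hau, huc.tail hcb⟩

/-- **LEMMA PRUNE.** If `u` is loop-free (on no closed walk through another vertex), deleting
`u` keeps every looped vertex looped: both halves of a closed walk `v →⁺ w →⁺ v` with `w ≠ v`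
avoid `u`, since otherwise `u` would lie on a closed walk through `v ≠ u`. -/
theorem looped_delete_of_loopFree {R : V → V → Prop} {u v : V}
    (hu : ¬ ∃ w, w ≠ u ∧ TransGen R u w ∧ TransGen R w u)
    (hv : ∃ w, w ≠ v ∧ TransGen R v w ∧ TransGen R w v) :
    ∃ w, w ≠ v ∧ TransGen (fun x y => R x y ∧ x ≠ u ∧ y ≠ u) v w ∧
      TransGen (fun x y => R x y ∧ x ≠ u ∧ y ≠ u) w v := by
  obtain ⟨w, hwv, hvw, hwv'⟩ := hv
  have hvu : v ≠ u := by
    rintro rfl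
    exact hu ⟨w, hwv, hvw, hwv'⟩
  refine ⟨w, hwv, ?_, ?_⟩
  · rcases transGen_avoid_or_through u hvw with h | ⟨hvu', huw⟩
    · exact h
    · exact absurd ⟨v, hvu, TransGen.trans_right huw hwv',
        transGen_of_reflTransGen_ne hvu' (Ne.symm hvu)⟩ hu
  · rcases transGen_avoid_or_through u hwv' with h | ⟨hwu, huv⟩
    · exact h
    · exact absurd ⟨v, hvu, transGen_of_reflTransGen_ne huv hvu,
        TransGen.trans_left hvw hwu⟩ hu

/-- For a loop-free vertex `u`, deleting `u` does not change which vertices are looped. -/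
theorem looped_delete_iff {R : V → V → Prop} {u : V}
    (hu : ¬ ∃ w, w ≠ u ∧ TransGen R u w ∧ TransGen R w u) (v : V) :
    (∃ w, w ≠ v ∧ TransGen (fun x y => R x y ∧ x ≠ u ∧ y ≠ u) v w ∧
        TransGen (fun x y => R x y ∧ x ≠ u ∧ y ≠ u) w v) ↔
      ∃ w, w ≠ v ∧ TransGen R v w ∧ TransGen R w v :=
  ⟨looped_of_looped_sub (fun _ _ h => h.1), looped_delete_of_loopFree hu⟩

/-- Deleting a whole list `l` of loop-free vertices keeps every looped vertex looped (induction
on `l`: the later vertices stay loop-free while the earlier ones are deleted, because fewer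
arcs never create a closed walk). -/
theorem looped_deleteList_of_loopFree {R : V → V → Prop} (l : List V)
    (hl : ∀ u ∈ l, ¬ ∃ w, w ≠ u ∧ TransGen R u w ∧ TransGen R w u) {v : V}
    (hv : ∃ w, w ≠ v ∧ TransGen R v w ∧ TransGen R w v) :
    ∃ w, w ≠ v ∧ TransGen (fun x y => R x y ∧ x ∉ l ∧ y ∉ l) v w ∧
      TransGen (fun x y => R x y ∧ x ∉ l ∧ y ∉ l) w v := by
  induction l with
  | nil =>
      exact looped_of_looped_sub (fun a b h => ⟨h, List.not_mem_nil, List.not_mem_nil⟩) hv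
  | cons u l ih =>
      have hl' : ∀ x ∈ l, ¬ ∃ w, w ≠ x ∧ TransGen R x w ∧ TransGen R w x :=
        fun x hx => hl x (List.mem_cons_of_mem u hx)
      have h1 := ih hl'
      -- `u` is loop-free for the `l`-deleted relation too (fewer arcs)
      have hu : ¬ ∃ w, w ≠ u ∧ TransGen (fun x y => R x y ∧ x ∉ l ∧ y ∉ l) u w ∧
          TransGen (fun x y => R x y ∧ x ∉ l ∧ y ∉ l) w u :=
        fun h => hl u List.mem_cons_self (looped_of_looped_sub (fun _ _ h => h.1) h)
      have h2 := looped_delete_of_loopFree hu h1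
      refine looped_of_looped_sub ?_ h2
      intro a b h
      obtain ⟨⟨hab, hal, hbl⟩, hau, hbu⟩ := h
      exact ⟨hab, fun ha => (List.mem_cons.1 ha).elim hau hal,
        fun hb => (List.mem_cons.1 hb).elim hbu hbl⟩

end LoopFreePruning

end Summit.Ventures.HSemireg
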